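import Summits.BirchSwinnertonDyer.Rank1Residual.Additive.LocIrrThreeCriteria
import HarnessLib

/-!
# The unit part of the discriminant mod 9 on the tame `e = 4` cell at `3` (Kodaira III / III*), in the
# Freitas–Kraus normal form `y² = x³ + a x² + b x`: the ARITHMETIC KERNEL of
# "`Δ̃ ≡ ±1 (mod 9)` ⟺ the selector `v₃(j − 1728) ≥ 7`" (PROVED; nothing asserted about any curve)

Cell `b2b-bsdres` (home `run/shared/lean/b2b/bsd-rank1-residual/`), census cell O5 = (t′), harvest seat 2
GEN 37, report `b2b-bsdres-harvest-2/gen37/E83-L-O5-G3-1-locators.md` §4 (b)–(c). HONEST FRAMING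
(verbatim in every file of the cell): the goal of the cell is to DELETE the COMBINATION-SHAPED residual
classes of the Birch–Swinnerton-Dyer formula for ALL analytic-rank `≤ 1` elliptic curves over `ℚ` — "full
BSD formula for every rank `≤ 1` curve in class `C`" assembled STRICTLY from published theorems — so that
the rank-`≤ 1` remainder becomes exactly the CONSTRUCTION-SHAPED classes, which are TYPED (missing-input
`Prop`s), NOT attempted. This is not "finishing BSD". This file: integer identities and two `mod 9` /
`3`-divisibility equivalences, all PROVED (`ring`, `decide` over `ZMod 9`); THEOREMS ONLY (no
`def` at all — the model `y² = x³ + a x² + b x` is the structure literal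
`WeierstrassCurve.mk 0 a 0 b 0`), no conjecture node, no Literature fact; it asserts nothing about
any elliptic curve. Typer of record for the O5 / Additive nodes is cc-typer-5
(`Additive/LocIrrThreeCriteria.lean`, `Additive/LocIrrValuationCriterionThree.lean`), whose
vocabulary `IsPmOneModNine` is reused; this sibling file may be folded or retired by the typer.

## What is proved, and why it is the kernel

Freitas–Kraus (Mem. AMS 277 (2022) no. 1361 = arXiv:1607.01218v5, §"The morphism `γ_E` in the tame case
`e = 4`", Lemma 19 (i), any `ℓ ≥ 3`): an elliptic curve over `ℚ_ℓ` with potentially good reduction and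
semistability defect `e = 4` has a model `y² = x³ + a x² + b x` with `Δ = Δ_m = 2⁴ b² (a² − 4b)` and
EITHER `υ(a) ≥ 1, υ(b) = 1, υ(a² − 4b) = 1` (Kodaira III, `υ(Δ_m) = 3`) OR `υ(a) ≥ 2, υ(b) = 3,
υ(a² − 4b) = 3` (Kodaira III*, `υ(Δ_m) = 9`). At `ℓ = 3` write `a = 3a′, b = 3b′` (III) or
`a = 9a′, b = 27b′` (III*) with `3 ∤ b′`. For this model (`a₁ = a₃ = a₆ = 0`, `a₂ = a`, `a₄ = b`):
`c₄ = 16(a² − 3b)`, `c₆ = −32 a (2a² − 9b)`, `Δ = 16 b² (a² − 4b)` (§1), hence (§2)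
`Δ = 3³·u` resp. `3⁹·u` with the SAME unit part `u = 16 b′² (3a′² − 4b′)`, and `c₆ = −864·w` resp.
`−23328·w` (`864 = 2⁵3³`, `23328 = 2⁵3⁶`) with the SAME `w = a′(2a′² − 3b′)`. The kernel (§3):
for `3 ∤ b′`,
* `u ≡ ±1 (mod 9) ⟺ 3 ∣ a′` (`u ≡ −b′³ + 3a′²b′² (mod 9)` and `b′³ ≡ ±1`), and
* `9 ∣ w ⟺ 3 ∣ a′`;
so `3⁵ ∣ c₆ ⟺ u ≡ ±1 (mod 9)` on type III and `3⁸ ∣ c₆ ⟺ u ≡ ±1 (mod 9)` on type III* (§4). Since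
`j − 1728 = c₆²/Δ`, "`3⁵ ∣ c₆`" (III, `v₃Δ = 3`) and "`3⁸ ∣ c₆`" (III*, `v₃Δ = 9`) are the selector
`v₃(j − 1728) ≥ 7` of o5-r1 / cc-typer-5 (`SelectorIdentityTameThree`: on O5b, `LocIrr W 3 ↔
7 ≤ v₃(j − 1728)`), and "`u ≡ ±1 (mod 9)`" is `IsPmOneModNine (minimalDiscUnitPartThree W)`, i.e. (as
`3 ∣ v₃Δ_min` here) `MinimalDiscIsCubeUnramifiedThree W` — the conclusion of o6-r1's theorem-candidate
`LocIrrThreeTameCube` (L-O6-irr). So, granted the selector identity, ON THE TAME CELL O5b the cube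
condition is not only necessary (L-O6-irr) but EQUIVALENT to `LocIrr W 3`. CENSUS (EVIDENCE, not used in
any proof): `u ≡ ±1 (mod 9)` ⟺ selector on 36 323 / 36 323 O5b rows of
`b2b-bsdres-o5-r1/census/o5_jmod_rows.tsv` (III LocIrr 4 922: `u ≡ 1/8` = 2 511/2 411; III generic
13 891: `u ≡ 2/4` = 6 633/7 258 — `4` exactly when `v₃c₄ = 2`, `2` when `v₃c₄ ≥ 3`; III* LocIrr
6 388: 3 275/3 113; III* generic 11 122: 5 520/5 602), `gen37/src/dtilde_check.py`. NOT provable from the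
`(v₃c₄, v₃c₆, v₃Δ)` pattern alone (`c₄ = 9, c₆ = 891, Δ = −459` has pattern `(2,4,3)` and `Δ̃ = −17 ≡ 1`):
the normal form is the input. Link to print: Conrad–Diamond–Taylor, JAMS 12 (1999), proof of Thm 7.2.1
(p. 553): for these curves, if `E[3]|G_{ℚ₃}` is reducible "one can compute this splitting field to be
`ℚ₃(√−3, Δ^{1/3})`, which is peu-ramifié because `3 ∣ v₃(Δ)`" — with `u ≢ ±1 (mod 9)` on every generic
row, `Δ` is not a cube in `ℚ₃^{nr}`, so that extension is ramified of degree 3 over `ℚ₃^{nr}(ζ₃)`: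
the inertial extension class is non-zero (o5-r1's `NonSplitAtThreeLaw`, G3-1′ — a sketch for the prover,
not proved here). The bridge from these integer statements to `WeierstrassCurve ℚ` / `padicValRat` /
`minimalDiscUnitPartThree` (minimality of the FK model at `3`, `j ≠ 1728`) is the typer's/prover's pen.

References: [cite: FreitasKraus2022, §19 Lemma 19 (i) (arXiv:1607.01218v5 numbering, p. 62)]
[cite: ConradDiamondTaylor1999, proof of Thm. 7.2.1 (p. 553)] [cite: Rizzo2003, Table II (rows III, III*)]
-/

set_option autoImplicit false

namespace Summit.BirchSwinnertonDyer.Rank1Residual.Additive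

namespace TameFourNormalForm

/-! ## §1 The invariants of the Freitas–Kraus model `y² = x³ + a x² + b x` = `WeierstrassCurve.mk 0 a 0 b 0`
(`a₁ = a₃ = a₆ = 0`; [cite: FreitasKraus2022, §19 Lemma 19 (i)]) -/

section Invariants

variable {R : Type*} [CommRing R] (a b : R)

/-- `c₄ = 16 (a² − 3b)`. [folklore] -/
theorem fk_c₄ : (WeierstrassCurve.mk 0 a 0 b 0 : WeierstrassCurve R).c₄ = 16 * (a ^ 2 - 3 * b) := by
  simp only [WeierstrassCurve.c₄, WeierstrassCurve.b₂, WeierstrassCurve.b₄]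
  ring

/-- `c₆ = −32 a (2a² − 9b)`. [folklore] -/
theorem fk_c₆ :
    (WeierstrassCurve.mk 0 a 0 b 0 : WeierstrassCurve R).c₆ = -32 * a * (2 * a ^ 2 - 9 * b) := by
  simp only [WeierstrassCurve.c₆, WeierstrassCurve.b₂, WeierstrassCurve.b₄, WeierstrassCurve.b₆]
  ring

/-- `Δ = 16 b² (a² − 4b)` (printed: `Δ = Δ_m = 2⁴ b² (a² − 4b)`).
[cite: FreitasKraus2022, §19 Lemma 19 (i)] -/
theorem fk_Δ :
    (WeierstrassCurve.mk 0 a 0 b 0 : WeierstrassCurve R).Δ = 16 * b ^ 2 * (a ^ 2 - 4 * b) := by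
  simp only [WeierstrassCurve.Δ, WeierstrassCurve.b₂, WeierstrassCurve.b₄, WeierstrassCurve.b₆,
    WeierstrassCurve.b₈]
  ring

end Invariants

/-! ## §2 The substitutions of the two Kodaira rows: a common unit part `u = 16 b′²(3a′² − 4b′)` and a
common `c₆`-cofactor `w = a′(2a′² − 3b′)` -/

/-- Type III (`a = 3a′, b = 3b′`): `Δ = 3³ · u`. [folklore] -/
theorem Δ_three (a' b' : ℤ) :
    (WeierstrassCurve.mk 0 (3 * a') 0 (3 * b') 0 : WeierstrassCurve ℤ).Δ =
      3 ^ 3 * (16 * b' ^ 2 * (3 * a' ^ 2 - 4 * b')) := by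
  rw [fk_Δ]; ring

/-- Type III* (`a = 9a′, b = 27b′`): `Δ = 3⁹ · u`. [folklore] -/
theorem Δ_threeStar (a' b' : ℤ) :
    (WeierstrassCurve.mk 0 (9 * a') 0 (27 * b') 0 : WeierstrassCurve ℤ).Δ =
      3 ^ 9 * (16 * b' ^ 2 * (3 * a' ^ 2 - 4 * b')) := by
  rw [fk_Δ]; ring

/-- Type III: `c₆ = −864 · w` (`864 = 2⁵·3³`). [folklore] -/
theorem c₆_three (a' b' : ℤ) :
    (WeierstrassCurve.mk 0 (3 * a') 0 (3 * b') 0 : WeierstrassCurve ℤ).c₆ =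
      -864 * (a' * (2 * a' ^ 2 - 3 * b')) := by
  rw [fk_c₆]; ring

/-- Type III*: `c₆ = −23328 · w` (`23328 = 2⁵·3⁶`). [folklore] -/
theorem c₆_threeStar (a' b' : ℤ) :
    (WeierstrassCurve.mk 0 (9 * a') 0 (27 * b') 0 : WeierstrassCurve ℤ).c₆ =
      -23328 * (a' * (2 * a' ^ 2 - 3 * b')) := by
  rw [fk_c₆]; ring

/-- Type III: `c₄ = 144 (a′² − b′)` — so `v₃(c₄) = 2` iff `a′² ≢ b′ (mod 3)` (the census split of the
generic rows into `u ≡ 4` / `u ≡ 2 (mod 9)`). [folklore] -/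
theorem c₄_three (a' b' : ℤ) :
    (WeierstrassCurve.mk 0 (3 * a') 0 (3 * b') 0 : WeierstrassCurve ℤ).c₄ = 144 * (a' ^ 2 - b') := by
  rw [fk_c₄]; ring

/-! ## §3 The kernel: two `decide`s over `ZMod 9` -/

/-- `t mod 9` reduces to a non-zero class mod `3` iff `3 ∤ t`. [folklore] -/
private theorem castHom_ne_zero_iff (t : ℤ) :
    ZMod.castHom (show 3 ∣ 9 by norm_num) (ZMod 3) (t : ZMod 9) ≠ 0 ↔ ¬ (3 : ℤ) ∣ t := by
  rw [map_intCast, Ne, ZMod.intCast_zmod_eq_zero_iff_dvd]; exact_mod_cast Iff.rfl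

/-- `t mod 9` reduces to `0` mod `3` iff `3 ∣ t`. [folklore] -/
private theorem castHom_eq_zero_iff (t : ℤ) :
    ZMod.castHom (show 3 ∣ 9 by norm_num) (ZMod 3) (t : ZMod 9) = 0 ↔ (3 : ℤ) ∣ t := by
  rw [map_intCast, ZMod.intCast_zmod_eq_zero_iff_dvd]; exact_mod_cast Iff.rfl

/-- **Kernel, discriminant side (PROVED).** For `3 ∤ b′`: `u = 16 b′²(3a′² − 4b′) ≡ ±1 (mod 9)` iff
`3 ∣ a′`. (`16 ≡ −2`, so `u ≡ −b′³ + 3a′²b′² (mod 9)` with `b′³ ≡ ±1`; if `3 ∤ a′` the second term is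
`≡ 3` and `u ∈ {2, 4} (mod 9)`.) [folklore] -/
theorem isPmOneModNine_unitPart_iff (a' b' : ℤ) (hb : ¬ (3 : ℤ) ∣ b') :
    IsPmOneModNine (16 * b' ^ 2 * (3 * a' ^ 2 - 4 * b')) ↔ (3 : ℤ) ∣ a' := by
  have key : ∀ x y : ZMod 9, ZMod.castHom (show 3 ∣ 9 by norm_num) (ZMod 3) y ≠ 0 →
      ((16 * y ^ 2 * (3 * x ^ 2 - 4 * y) = 1 ∨ 16 * y ^ 2 * (3 * x ^ 2 - 4 * y) = 8) ↔
        ZMod.castHom (show 3 ∣ 9 by norm_num) (ZMod 3) x = 0) := by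
    decide
  have hb' := (castHom_ne_zero_iff b').mpr hb
  have := key (a' : ZMod 9) (b' : ZMod 9) hb'
  rw [castHom_eq_zero_iff] at this
  rw [isPmOneModNine_iff_zmod]
  push_cast
  exact this

/-- The generic complement: for `3 ∤ b′` and `3 ∤ a′`, `u ≡ 2` or `4 (mod 9)` — `4` iff `b′ ≡ 2 (mod 3)`
(equivalently `v₃(c₄) = 2` on type III, by `c₄_three`), `2` iff `b′ ≡ 1 (mod 3)`. [folklore] -/
theorem unitPart_emod_nine_of_not_dvd (a' b' : ℤ) (hb : ¬ (3 : ℤ) ∣ b') (ha : ¬ (3 : ℤ) ∣ a') :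
    16 * b' ^ 2 * (3 * a' ^ 2 - 4 * b') % 9 = 2 ∨ 16 * b' ^ 2 * (3 * a' ^ 2 - 4 * b') % 9 = 4 := by
  have key : ∀ x y : ZMod 9, ZMod.castHom (show 3 ∣ 9 by norm_num) (ZMod 3) y ≠ 0 →
      ZMod.castHom (show 3 ∣ 9 by norm_num) (ZMod 3) x ≠ 0 →
        (16 * y ^ 2 * (3 * x ^ 2 - 4 * y) = 2 ∨ 16 * y ^ 2 * (3 * x ^ 2 - 4 * y) = 4) := by
    decide
  have h := key (a' : ZMod 9) (b' : ZMod 9) ((castHom_ne_zero_iff b').mpr hb)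
    ((castHom_ne_zero_iff a').mpr ha)
  set u : ℤ := 16 * b' ^ 2 * (3 * a' ^ 2 - 4 * b') with hu
  have h2 : ((u : ℤ) : ZMod 9) = 2 ↔ u % 9 = 2 := by
    rw [show (2 : ZMod 9) = ((2 : ℤ) : ZMod 9) by norm_num, ZMod.intCast_eq_intCast_iff]
    simp [Int.ModEq]
  have h4 : ((u : ℤ) : ZMod 9) = 4 ↔ u % 9 = 4 := by
    rw [show (4 : ZMod 9) = ((4 : ℤ) : ZMod 9) by norm_num, ZMod.intCast_eq_intCast_iff]
    simp [Int.ModEq]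
  rw [← h2, ← h4, hu]
  push_cast
  exact h

/-- **Kernel, `c₆` side (PROVED).** For `3 ∤ b′`: `9 ∣ w = a′(2a′² − 3b′)` iff `3 ∣ a′` (if `3 ∣ a′`
both factors are divisible by `3`; if not, neither is). [folklore] -/
theorem nine_dvd_c₆Cofactor_iff (a' b' : ℤ) (hb : ¬ (3 : ℤ) ∣ b') :
    (9 : ℤ) ∣ a' * (2 * a' ^ 2 - 3 * b') ↔ (3 : ℤ) ∣ a' := by
  have key : ∀ x y : ZMod 9, ZMod.castHom (show 3 ∣ 9 by norm_num) (ZMod 3) y ≠ 0 →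
      (x * (2 * x ^ 2 - 3 * y) = 0 ↔ ZMod.castHom (show 3 ∣ 9 by norm_num) (ZMod 3) x = 0) := by
    decide
  have := key (a' : ZMod 9) (b' : ZMod 9) ((castHom_ne_zero_iff b').mpr hb)
  rw [castHom_eq_zero_iff] at this
  set w : ℤ := a' * (2 * a' ^ 2 - 3 * b') with hw
  have hz : ((w : ZMod 9) = 0) ↔ (9 : ℤ) ∣ w := by
    exact_mod_cast ZMod.intCast_zmod_eq_zero_iff_dvd w 9
  rw [← hz, hw]
  push_cast
  exact this

/-! ## §4 The selector ⟺ the unit part, on each Kodaira row of the normal form -/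

/-- `3⁵ ∣ −864·w ⟺ 9 ∣ w` (`864 = 2⁵·3³`). [folklore] -/
theorem pow_five_dvd_iff (w : ℤ) : (3 : ℤ) ^ 5 ∣ -864 * w ↔ (9 : ℤ) ∣ w := by
  constructor
  · rintro ⟨k, hk⟩
    have h27 : (27 : ℤ) * (-32 * w) = 27 * (9 * k) := by linarith
    have h := mul_left_cancel₀ (by norm_num : (27 : ℤ) ≠ 0) h27
    have : (9 : ℤ) ∣ -32 * w := ⟨k, h⟩
    have hcop : IsCoprime (9 : ℤ) (-32) := by norm_num [Int.isCoprime_iff_gcd_eq_one]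
    exact hcop.dvd_of_dvd_mul_left this
  · rintro ⟨k, hk⟩
    exact ⟨-32 * k, by rw [hk]; ring⟩

/-- `3⁸ ∣ −23328·w ⟺ 9 ∣ w` (`23328 = 2⁵·3⁶`). [folklore] -/
theorem pow_eight_dvd_iff (w : ℤ) : (3 : ℤ) ^ 8 ∣ -23328 * w ↔ (9 : ℤ) ∣ w := by
  constructor
  · rintro ⟨k, hk⟩
    have h729 : (729 : ℤ) * (-32 * w) = 729 * (9 * k) := by linarith
    have h := mul_left_cancel₀ (by norm_num : (729 : ℤ) ≠ 0) h729
    have : (9 : ℤ) ∣ -32 * w := ⟨k, h⟩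
    have hcop : IsCoprime (9 : ℤ) (-32) := by norm_num [Int.isCoprime_iff_gcd_eq_one]
    exact hcop.dvd_of_dvd_mul_left this
  · rintro ⟨k, hk⟩
    exact ⟨-32 * k, by rw [hk]; ring⟩

/-- **Type III row (PROVED):** for `3 ∤ b′`, `3⁵ ∣ c₆(y² = x³ + 3a′x² + 3b′x)` iff the unit part
`u = Δ/3³ = 16 b′²(3a′² − 4b′)` is `≡ ±1 (mod 9)` — i.e. (with `v₃Δ = 3`, `j − 1728 = c₆²/Δ`) the selector
`v₃(j − 1728) ≥ 7` iff `Δ̃ ≡ ±1 (mod 9)`. [folklore] -/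
theorem selector_iff_unitPart_three (a' b' : ℤ) (hb : ¬ (3 : ℤ) ∣ b') :
    (3 : ℤ) ^ 5 ∣ (WeierstrassCurve.mk 0 (3 * a') 0 (3 * b') 0 : WeierstrassCurve ℤ).c₆ ↔
      IsPmOneModNine (16 * b' ^ 2 * (3 * a' ^ 2 - 4 * b')) := by
  rw [c₆_three, pow_five_dvd_iff, nine_dvd_c₆Cofactor_iff a' b' hb,
    isPmOneModNine_unitPart_iff a' b' hb]

/-- **Type III* row (PROVED):** for `3 ∤ b′`, `3⁸ ∣ c₆(y² = x³ + 9a′x² + 27b′x)` iff the unit part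
`u = Δ/3⁹ = 16 b′²(3a′² − 4b′)` is `≡ ±1 (mod 9)` — i.e. (with `v₃Δ = 9`) the selector
`v₃(j − 1728) ≥ 7` iff `Δ̃ ≡ ±1 (mod 9)`. [folklore] -/
theorem selector_iff_unitPart_threeStar (a' b' : ℤ) (hb : ¬ (3 : ℤ) ∣ b') :
    (3 : ℤ) ^ 8 ∣ (WeierstrassCurve.mk 0 (9 * a') 0 (27 * b') 0 : WeierstrassCurve ℤ).c₆ ↔
      IsPmOneModNine (16 * b' ^ 2 * (3 * a' ^ 2 - 4 * b')) := by
  rw [c₆_threeStar, pow_eight_dvd_iff, nine_dvd_c₆Cofactor_iff a' b' hb,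
    isPmOneModNine_unitPart_iff a' b' hb]

/-- Sanity: `a′ = 1, b′ = 1` (`3 ∤ a′`): `u = 16·(3 − 4) = −16 ≡ 2 (mod 9)`, not `±1`. -/
example : ¬ IsPmOneModNine (16 * (1 : ℤ) ^ 2 * (3 * 1 ^ 2 - 4 * 1)) := by decide

/-- Sanity: `a′ = 3, b′ = 1` (`3 ∣ a′`): `u = 16·(27 − 4) = 368 ≡ 8 ≡ −1 (mod 9)`. -/
example : IsPmOneModNine (16 * (1 : ℤ) ^ 2 * (3 * 3 ^ 2 - 4 * 1)) := by decide

end TameFourNormalForm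

end Summit.BirchSwinnertonDyer.Rank1Residual.Additive
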